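import Mathlib.Analysis.Complex.ExponentialBounds
import Literature.NumberTheory.LFunctions.DeBruijnPhiLogDerivEnvelope
import Literature.NumberTheory.LFunctions.XiTiltedPotential
import Summits.RiemannHypothesis.RiemannHypothesis.Theorems.JensenPolynomialsPhiHigherDeriv
import HarnessLib

/-!
# Route `JensenPolynomials`, far skewness crux `XiCumulantSkew98Far` — toolbox for the envelopes of `ψ‴`, `ψ⁗`
(`ψ = −log Φ`; RH-FREE; cell rh-jensen, HUMAN RULING D-0040 / D-0074)

LINE 1 (D-0074 framing): everything here is RH-FREE real analysis of the Pólya–de Bruijn kernel `Φ = deBruijnPhi`;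
nothing in this file bears on the zeros of `ζ` or is progress toward RH.

The Stein-hierarchy proof design for the far skewness cap `q(M) = M·Ũ₃(M)² ≤ 81/2` (crux `XiCumulantSkew98Far`,
HOME memo `eng-5/stein/BLUEPRINT-19216.md`, §2 and §5) consumes exactly four pointwise facts about `ψ := −log Φ` on
the bulk `u ≥ 3/2`: the envelopes (E1) `ψ′ ∈ [4πe^{4u} − 9.005, 4πe^{4u} − 9]` and (E2)
`ψ″ ∈ (16πe^{4u}, 16πe^{4u}(1 + 10⁻⁶)]`, which are tree theorems (`DeBruijnPhiLogDerivEnvelope.lean`,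
`DeBruijnPhiLogConcave.lean`), and (E3) `ψ‴ ∈ [64πe^{4u}(1 − 10⁻⁶), 64πe^{4u}]`,
(E4) `ψ⁗ ∈ [256πe^{4u}, 256πe^{4u}(1 + 10⁻⁶)]`, proved in the sequel `JensenPolynomialsPhiLogDerivEnvelope34.lean`.
This file is the toolbox of that sequel:

* §1 the objects `phiNegLogDeriv₃ = ψ‴ = (−Φ²Φ‴ + 3ΦΦ′Φ″ − 2Φ′³)/Φ³` and
  `phiNegLogDeriv₄ = ψ⁗ = (6Φ′⁴ − 12ΦΦ′²Φ″ + 3Φ²Φ″² + 4Φ²Φ′Φ‴ − Φ³Φ⁗)/Φ⁴` with `(ψ″)′ = ψ‴`, `(ψ‴)′ = ψ⁗`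
  (the tree's `phiNegLogDeriv`, `phiNegLogDeriv₂`, `deBruijnPhiDeriv₃`, `deBruijnPhiDeriv₄`);
* §2 numerics: `πe^{4u} ≥ 1267.4` for `u ≥ 3/2` and the tail scale `θ(y) = (64/63)·4⁶·e^{−3y}` (written out, no definition) with `θ·y⁷ ≤ 10⁻⁶`
  (the conversion `e^{y}·(tail of degree d ≤ 6) ≤ θ·(head size)`);
* §3 generic product-perturbation inequalities `|∏(a_i + t_i) − ∏a_i| ≤ (2^k − 1)θ∏B_i` (`k = 2, 3, 4`).
The theta-series tails of degree `≤ 6` and the heads `P₂, P₃, P₄` are in the companion `JensenPolynomialsPhiThetaTails6.lean`.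

WHAT THIS IS NOT: not a statement about `ξ`'s zeros; the envelopes are asymptotic-expansion error terms of
`−log Φ` made explicit. References: M. W. Coffey, G. Csordas, Math. Comp. 82 (2013), Prop. 2.1, Lemma 2.2,
(2.8)–(2.11) [CoffeyCsordas2013]; G. Csordas, T. S. Norfolk, R. S. Varga, Trans. AMS 296 (1986) §3 [CsordasNorfolkVarga1986].
-/

noncomputable section

open Filter Set
open scoped Real Topology

-- D-0017: `Summit.RiemannHypothesis.RiemannHypothesis.…` duplicates the namespace BY DESIGN (single-problem summit).
set_option linter.dupNamespace false

namespace Summit.RiemannHypothesis.RiemannHypothesis.Theorems.JensenPolynomials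

open Literature.NumberTheory.LFunctions

/-! ## 1. `ψ‴` and `ψ⁗` -/

/-- `ψ‴ = −(log Φ)‴ = (−Φ²Φ‴ + 3ΦΦ′Φ″ − 2Φ′³)/Φ³` (the derivative of the tree's `phiNegLogDeriv₂ = −(log Φ)″`). -/
def phiNegLogDeriv₃ (u : ℝ) : ℝ :=
  (-(deBruijnPhi u ^ 2 * deBruijnPhiDeriv₃ u) + 3 * deBruijnPhi u * deBruijnPhiDeriv u * deBruijnPhiDeriv₂ u -
      2 * deBruijnPhiDeriv u ^ 3) / deBruijnPhi u ^ 3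

/-- `ψ⁗ = −(log Φ)⁗ = (6Φ′⁴ − 12ΦΦ′²Φ″ + 3Φ²Φ″² + 4Φ²Φ′Φ‴ − Φ³Φ⁗)/Φ⁴`. -/
def phiNegLogDeriv₄ (u : ℝ) : ℝ :=
  (6 * deBruijnPhiDeriv u ^ 4 - 12 * deBruijnPhi u * deBruijnPhiDeriv u ^ 2 * deBruijnPhiDeriv₂ u +
      3 * deBruijnPhi u ^ 2 * deBruijnPhiDeriv₂ u ^ 2 + 4 * deBruijnPhi u ^ 2 * deBruijnPhiDeriv u * deBruijnPhiDeriv₃ u -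
      deBruijnPhi u ^ 3 * deBruijnPhiDeriv₄ u) / deBruijnPhi u ^ 4

/-- `(ψ″)′ = ψ‴`: `HasDerivAt phiNegLogDeriv₂ (phiNegLogDeriv₃ u) u`. -/
theorem hasDerivAt_phiNegLogDeriv₂_three (u : ℝ) : HasDerivAt phiNegLogDeriv₂ (phiNegLogDeriv₃ u) u := by
  have h0 := hasDerivAt_deBruijnPhi u
  have h1 := hasDerivAt_deBruijnPhiDeriv u
  have h2 := hasDerivAt_deBruijnPhiDeriv₂ u
  have hΦ : deBruijnPhi u ≠ 0 := (deBruijnPhi_pos_holds u).ne'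
  have hnum := (h1.fun_mul h1).fun_sub (h0.fun_mul h2)
  have hden := h0.fun_mul h0
  have h := hnum.div hden (mul_ne_zero hΦ hΦ)
  have ef : phiNegLogDeriv₂ = fun t => (deBruijnPhiDeriv t * deBruijnPhiDeriv t - deBruijnPhi t * deBruijnPhiDeriv₂ t) /
      (deBruijnPhi t * deBruijnPhi t) := by
    funext t; simp only [phiNegLogDeriv₂]; ring
  rw [ef]
  refine h.congr_deriv ?_
  unfold phiNegLogDeriv₃
  field_simp
  ring

/-- `(ψ‴)′ = ψ⁗`: `HasDerivAt phiNegLogDeriv₃ (phiNegLogDeriv₄ u) u`. -/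
theorem hasDerivAt_phiNegLogDeriv₃ (u : ℝ) : HasDerivAt phiNegLogDeriv₃ (phiNegLogDeriv₄ u) u := by
  have h0 := hasDerivAt_deBruijnPhi u
  have h1 := hasDerivAt_deBruijnPhiDeriv u
  have h2 := hasDerivAt_deBruijnPhiDeriv₂ u
  have h3 := hasDerivAt_deBruijnPhiDeriv₃ u
  have hΦ : deBruijnPhi u ≠ 0 := (deBruijnPhi_pos_holds u).ne'
  have hnum := (((((h0.fun_mul h1).fun_mul h2).const_mul 3).fun_sub ((h0.fun_mul h0).fun_mul h3))).fun_sub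
    (((h1.fun_mul h1).fun_mul h1).const_mul 2)
  have hden := (h0.fun_mul h0).fun_mul h0
  have h := hnum.div hden (mul_ne_zero (mul_ne_zero hΦ hΦ) hΦ)
  have ef : phiNegLogDeriv₃ = fun t => (3 * (deBruijnPhi t * deBruijnPhiDeriv t * deBruijnPhiDeriv₂ t) -
      deBruijnPhi t * deBruijnPhi t * deBruijnPhiDeriv₃ t -
      2 * (deBruijnPhiDeriv t * deBruijnPhiDeriv t * deBruijnPhiDeriv t)) /
      (deBruijnPhi t * deBruijnPhi t * deBruijnPhi t) := by
    funext t; simp only [phiNegLogDeriv₃]; ring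
  rw [ef]
  refine h.congr_deriv ?_
  unfold phiNegLogDeriv₄
  field_simp
  ring

/-- `ψ‴Φ³ = −Φ²Φ‴ + 3ΦΦ′Φ″ − 2Φ′³` (clearing the denominator). -/
theorem phiNegLogDeriv₃_mul_pow (u : ℝ) :
    phiNegLogDeriv₃ u * deBruijnPhi u ^ 3 =
      -(deBruijnPhi u ^ 2 * deBruijnPhiDeriv₃ u) + 3 * deBruijnPhi u * deBruijnPhiDeriv u * deBruijnPhiDeriv₂ u -
        2 * deBruijnPhiDeriv u ^ 3 := by
  unfold phiNegLogDeriv₃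
  exact div_mul_cancel₀ _ (pow_ne_zero 3 (deBruijnPhi_pos_holds u).ne')

/-- `ψ⁗Φ⁴ = 6Φ′⁴ − 12ΦΦ′²Φ″ + 3Φ²Φ″² + 4Φ²Φ′Φ‴ − Φ³Φ⁗` (clearing the denominator). -/
theorem phiNegLogDeriv₄_mul_pow (u : ℝ) :
    phiNegLogDeriv₄ u * deBruijnPhi u ^ 4 =
      6 * deBruijnPhiDeriv u ^ 4 - 12 * deBruijnPhi u * deBruijnPhiDeriv u ^ 2 * deBruijnPhiDeriv₂ u +
        3 * deBruijnPhi u ^ 2 * deBruijnPhiDeriv₂ u ^ 2 + 4 * deBruijnPhi u ^ 2 * deBruijnPhiDeriv u * deBruijnPhiDeriv₃ u -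
        deBruijnPhi u ^ 3 * deBruijnPhiDeriv₄ u := by
  unfold phiNegLogDeriv₄
  exact div_mul_cancel₀ _ (pow_ne_zero 4 (deBruijnPhi_pos_holds u).ne')

/-! ## 2. Numerics: the bulk threshold `πe^{4u} ≥ 1267.4` and the tail scale `θ` -/

/-- `πe⁶ > 1267.4` (`e > 2.7182818283`, `π > 3.141592`). -/
theorem pi_mul_exp_six_gt' : 1267.4 < π * rexp 6 := by
  have he : (2.7182818283 : ℝ) ^ 6 < rexp 6 := by
    have h := Real.exp_one_gt_d9
    have : rexp 6 = rexp 1 ^ 6 := by rw [← Real.exp_nat_mul]; norm_num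
    rw [this]
    exact pow_lt_pow_left₀ h (by norm_num) (by norm_num)
  have h6 : (403.42 : ℝ) < rexp 6 := lt_trans (by norm_num) he
  nlinarith [Real.pi_gt_d6, Real.exp_pos (6 : ℝ)]

/-- For `u ≥ 3/2`: `πe^{4u} ≥ 1267.4`. -/
theorem pi_mul_exp_four_mul_ge {u : ℝ} (hu : 3 / 2 ≤ u) : 1267.4 ≤ π * rexp (4 * u) := by
  have h : rexp 6 ≤ rexp (4 * u) := Real.exp_le_exp.2 (by linarith)
  nlinarith [pi_mul_exp_six_gt', Real.pi_pos]

/-- The tail scale of the envelopes is `θ(y) := (64/63)·4⁶·e^{−3y}` (every `n ≥ 1` theta tail, divided by the head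
weight `e^{−y}` and by the head size `4^m·2·y^{m+2}`, is at most `θ`); `θ(y) > 0`. -/
theorem envTheta_pos (y : ℝ) : 0 < 64 / 63 * 4 ^ 6 * rexp (-(3 * y)) := by positivity

/-- **`θ(y)·y⁷ ≤ 10⁻⁶` for `y ≥ 1267.4`** (`e^{3y} ≥ (3y)¹⁴/14!`, so `y⁷e^{−3y} ≤ 14!/(3¹⁴y⁷) ≤ 3.5·10⁻¹⁸`). -/
theorem envTheta_mul_pow_seven_le {y : ℝ} (hy : 1267.4 ≤ y) :
    64 / 63 * 4 ^ 6 * rexp (-(3 * y)) * y ^ 7 ≤ 1 / 10 ^ 6 := by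
  have hy0 : 0 < y := by linarith
  have h3y : 0 ≤ 3 * y := by linarith
  have hfac := Real.pow_div_factorial_le_exp (3 * y) h3y 14
  have hexp : 0 < rexp (3 * y) := Real.exp_pos _
  have hf0 : (0 : ℝ) < (Nat.factorial 14 : ℝ) := by positivity
  -- `e^{−3y} · (3y)¹⁴ ≤ 14!`
  have h1 : rexp (-(3 * y)) * (3 * y) ^ 14 ≤ (Nat.factorial 14 : ℝ) := by
    rw [div_le_iff₀ hf0] at hfac
    rw [Real.exp_neg]
    have : (rexp (3 * y))⁻¹ * (3 * y) ^ 14 = (3 * y) ^ 14 / rexp (3 * y) := by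
      rw [div_eq_mul_inv, mul_comm]
    rw [this, div_le_iff₀ hexp]
    linarith
  have h14 : (Nat.factorial 14 : ℝ) = 87178291200 := by norm_num [Nat.factorial]
  rw [h14] at h1
  -- `y¹⁴ ≥ 1267.4⁷ · y⁷`
  have hy7 : (1267.4 : ℝ) ^ 7 ≤ y ^ 7 := pow_le_pow_left₀ (by norm_num) hy 7
  have hsplit : (3 * y) ^ 14 = 3 ^ 14 * (y ^ 7 * y ^ 7) := by ring
  rw [hsplit] at h1
  have hθ0 : 0 ≤ rexp (-(3 * y)) := (Real.exp_pos _).le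
  have hyy : 0 ≤ y ^ 7 := by positivity
  -- `θ y⁷ · (3¹⁴·1267.4⁷) ≤ θ y⁷ · 3¹⁴ y⁷ = (64/63)4⁶ · [e^{−3y} 3¹⁴ y¹⁴] ≤ (64/63)4⁶·14!`
  have h2 : 64 / 63 * 4 ^ 6 * rexp (-(3 * y)) * y ^ 7 * (3 ^ 14 * (1267.4 : ℝ) ^ 7) ≤
      64 / 63 * 4 ^ 6 * 87178291200 := by
    have hA : rexp (-(3 * y)) * (3 ^ 14 * (y ^ 7 * (1267.4 : ℝ) ^ 7)) ≤
        rexp (-(3 * y)) * (3 ^ 14 * (y ^ 7 * y ^ 7)) :=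
      mul_le_mul_of_nonneg_left (mul_le_mul_of_nonneg_left (mul_le_mul_of_nonneg_left hy7 hyy) (by norm_num)) hθ0
    have hB : 64 / 63 * 4 ^ 6 * rexp (-(3 * y)) * y ^ 7 * (3 ^ 14 * (1267.4 : ℝ) ^ 7) =
        64 / 63 * 4 ^ 6 * (rexp (-(3 * y)) * (3 ^ 14 * (y ^ 7 * (1267.4 : ℝ) ^ 7))) := by ring
    rw [hB]
    nlinarith
  have hc : (0 : ℝ) < 3 ^ 14 * (1267.4 : ℝ) ^ 7 := by positivity
  rw [← le_div_iff₀ hc] at h2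
  refine h2.trans ?_
  rw [div_le_iff₀ hc]
  norm_num

/-- `θ(y) ≤ 10⁻⁶` (in particular `θ ≤ 1`) for `y ≥ 1267.4`. -/
theorem envTheta_le {y : ℝ} (hy : 1267.4 ≤ y) : 64 / 63 * 4 ^ 6 * rexp (-(3 * y)) ≤ 1 / 10 ^ 6 := by
  have h := envTheta_mul_pow_seven_le hy
  have h1 : 1 ≤ y ^ 7 := one_le_pow₀ (by linarith)
  nlinarith [envTheta_pos y]

/-- `e^{y}·e^{−4y} = e^{−3y}`. -/
theorem exp_mul_exp_neg_four_mul (y : ℝ) : rexp y * rexp (-(4 * y)) = rexp (-(3 * y)) := by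
  rw [← Real.exp_add]; congr 1; ring

/-- The tail-to-head conversion: for `d ≤ 6` and `C ≥ 0`,
`e^{y}·C·(64/63)·4^d·(y^d e^{−4y}) ≤ θ(y)·(C·y^d)`. -/
theorem exp_mul_tail_le_envTheta {y C : ℝ} (hC : 0 ≤ C) (hy : 0 ≤ y) {d : ℕ} (hd : d ≤ 6) :
    rexp y * (C * (64 / 63 * 4 ^ d * (y ^ d * rexp (-(4 * y))))) ≤
      64 / 63 * 4 ^ 6 * rexp (-(3 * y)) * (C * y ^ d) := by
  have h4 : (4 : ℝ) ^ d ≤ 4 ^ 6 := pow_le_pow_right₀ (by norm_num) hd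
  have e : rexp y * (C * (64 / 63 * 4 ^ d * (y ^ d * rexp (-(4 * y))))) =
      4 ^ d * (64 / 63 * (rexp y * rexp (-(4 * y))) * (C * y ^ d)) := by ring
  rw [e, exp_mul_exp_neg_four_mul]
  have h0 : 0 ≤ 64 / 63 * rexp (-(3 * y)) * (C * y ^ d) := by positivity
  calc 4 ^ d * (64 / 63 * rexp (-(3 * y)) * (C * y ^ d))
      ≤ 4 ^ 6 * (64 / 63 * rexp (-(3 * y)) * (C * y ^ d)) := mul_le_mul_of_nonneg_right h4 h0
    _ = 64 / 63 * 4 ^ 6 * rexp (-(3 * y)) * (C * y ^ d) := by ring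

/-! ## 3. Generic product-perturbation inequalities -/

/-- Two factors: `|a| ≤ A`, `|b| ≤ B`, `|s − a| ≤ θA`, `|t − b| ≤ θB`, `0 ≤ θ ≤ 1` ⟹ `|st − ab| ≤ 3θ·AB`. -/
theorem abs_mul_two_sub_le {a b s t A B θ : ℝ} (hθ : 0 ≤ θ) (hθ1 : θ ≤ 1) (ha : |a| ≤ A) (hb : |b| ≤ B)
    (hs : |s - a| ≤ θ * A) (ht : |t - b| ≤ θ * B) : |s * t - a * b| ≤ 3 * θ * (A * B) := by
  have hA : 0 ≤ A := (abs_nonneg a).trans ha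
  have hB : 0 ≤ B := (abs_nonneg b).trans hb
  have e : s * t - a * b = (s - a) * (t - b) + (s - a) * b + a * (t - b) := by ring
  rw [e]
  have h1 : |(s - a) * (t - b)| ≤ θ * A * (θ * B) := by
    rw [abs_mul]; exact mul_le_mul hs ht (abs_nonneg _) (by positivity)
  have h2 : |(s - a) * b| ≤ θ * A * B := by
    rw [abs_mul]; exact mul_le_mul hs hb (abs_nonneg _) (by positivity)
  have h3 : |a * (t - b)| ≤ A * (θ * B) := by
    rw [abs_mul]; exact mul_le_mul ha ht (abs_nonneg _) hA
  have hθθ : θ * A * (θ * B) ≤ θ * A * B := by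
    have : θ * B ≤ B := by nlinarith
    exact mul_le_mul_of_nonneg_left this (by positivity)
  calc |(s - a) * (t - b) + (s - a) * b + a * (t - b)|
      ≤ |(s - a) * (t - b)| + |(s - a) * b| + |a * (t - b)| := abs_add_three _ _ _
    _ ≤ θ * A * B + θ * A * B + A * (θ * B) := by linarith
    _ = 3 * θ * (A * B) := by ring

/-- Three factors: `|str − abc| ≤ 7θ·ABC` under the same hypotheses. -/
theorem abs_mul_three_sub_le {a b c s t r A B C θ : ℝ} (hθ : 0 ≤ θ) (hθ1 : θ ≤ 1) (ha : |a| ≤ A) (hb : |b| ≤ B)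
    (hc : |c| ≤ C) (hs : |s - a| ≤ θ * A) (ht : |t - b| ≤ θ * B) (hr : |r - c| ≤ θ * C) :
    |s * t * r - a * b * c| ≤ 7 * θ * (A * B * C) := by
  have hA : 0 ≤ A := (abs_nonneg a).trans ha
  have hB : 0 ≤ B := (abs_nonneg b).trans hb
  have hC : 0 ≤ C := (abs_nonneg c).trans hc
  have h2 := abs_mul_two_sub_le hθ hθ1 ha hb hs ht
  have e : s * t * r - a * b * c = (s * t - a * b) * r + (a * b) * (r - c) := by ring
  rw [e]
  have hrle : |r| ≤ 2 * C := by
    have : |r| ≤ |c| + |r - c| := by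
      have := abs_add_le c (r - c); simp only [add_sub_cancel] at this; exact this
    nlinarith
  have hab : |a * b| ≤ A * B := by rw [abs_mul]; exact mul_le_mul ha hb (abs_nonneg _) hA
  have k1 : |(s * t - a * b) * r| ≤ 3 * θ * (A * B) * (2 * C) := by
    rw [abs_mul]; exact mul_le_mul h2 hrle (abs_nonneg _) (by positivity)
  have k2 : |a * b * (r - c)| ≤ A * B * (θ * C) := by
    rw [abs_mul]; exact mul_le_mul hab hr (abs_nonneg _) (by positivity)
  calc |(s * t - a * b) * r + a * b * (r - c)| ≤ |(s * t - a * b) * r| + |a * b * (r - c)| := abs_add_le _ _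
    _ ≤ 3 * θ * (A * B) * (2 * C) + A * B * (θ * C) := by linarith
    _ = 7 * θ * (A * B * C) := by ring

/-- Four factors: `|strq − abcd| ≤ 15θ·ABCD` under the same hypotheses. -/
theorem abs_mul_four_sub_le {a b c d s t r q A B C D θ : ℝ} (hθ : 0 ≤ θ) (hθ1 : θ ≤ 1) (ha : |a| ≤ A)
    (hb : |b| ≤ B) (hc : |c| ≤ C) (hd : |d| ≤ D) (hs : |s - a| ≤ θ * A) (ht : |t - b| ≤ θ * B)
    (hr : |r - c| ≤ θ * C) (hq : |q - d| ≤ θ * D) :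
    |s * t * r * q - a * b * c * d| ≤ 15 * θ * (A * B * C * D) := by
  have hA : 0 ≤ A := (abs_nonneg a).trans ha
  have hB : 0 ≤ B := (abs_nonneg b).trans hb
  have hC : 0 ≤ C := (abs_nonneg c).trans hc
  have hD : 0 ≤ D := (abs_nonneg d).trans hd
  have h3 := abs_mul_three_sub_le hθ hθ1 ha hb hc hs ht hr
  have e : s * t * r * q - a * b * c * d = (s * t * r - a * b * c) * q + (a * b * c) * (q - d) := by ring
  rw [e]
  have hqle : |q| ≤ 2 * D := by
    have : |q| ≤ |d| + |q - d| := by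
      have := abs_add_le d (q - d); simp only [add_sub_cancel] at this; exact this
    nlinarith
  have habc : |a * b * c| ≤ A * B * C := by
    rw [abs_mul, abs_mul]
    exact mul_le_mul (mul_le_mul ha hb (abs_nonneg _) hA) hc (abs_nonneg _) (by positivity)
  have k1 : |(s * t * r - a * b * c) * q| ≤ 7 * θ * (A * B * C) * (2 * D) := by
    rw [abs_mul]; exact mul_le_mul h3 hqle (abs_nonneg _) (by positivity)
  have k2 : |a * b * c * (q - d)| ≤ A * B * C * (θ * D) := by
    rw [abs_mul]; exact mul_le_mul habc hq (abs_nonneg _) (by positivity)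
  calc |(s * t * r - a * b * c) * q + a * b * c * (q - d)|
      ≤ |(s * t * r - a * b * c) * q| + |a * b * c * (q - d)| := abs_add_le _ _
    _ ≤ 7 * θ * (A * B * C) * (2 * D) + A * B * C * (θ * D) := by linarith
    _ = 15 * θ * (A * B * C * D) := by ring

end Summit.RiemannHypothesis.RiemannHypothesis.Theorems.JensenPolynomials

end
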